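import Literature.AlgebraicGeometry.Frobenioids.EquivalencePreStepsPerfect
import Literature.AlgebraicGeometry.Frobenioids.EquivalencePreStepsQuasiIsotropicFSMFF2024
import Literature.AlgebraicGeometry.Frobenioids.Isotropification
import Literature.AlgebraicGeometry.Frobenioids.PreFrobenioidEquivalence
import Literature.AlgebraicGeometry.Frobenioids.EquivalenceThm34iiiOfPreSteps
import Literature.AlgebraicGeometry.Frobenioids.EquivalenceThm34ivvOfThm34iii
import HarnessLib

/-!
# Frobenioids I, Theorem 3.4 (ii)–(v) AS TYPED, hypotheses VERBATIM, for every Frobenioid of PERFECT type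

Mochizuki, *The geometry of Frobenioids I: the general theory*, Kyushu J. Math. **62** (2008) 293–400,
Thm. 3.4 (ii)–(v), kurims pp. 62–63, proof pp. 63–69 [cite: MochizukiFrdI2008, Thm. 3.4 (ii) p.62];
Prop. 1.9 (v) (the isotropification `C^istr`), p. 32 [cite: MochizukiFrdI2008, Prop. 1.9(v) p.32].

PROOF-ONLY file (seat abc-iut-w4-d093). `EquivalencePreStepsPerfect.lean` proves Thm. 3.4 (ii) with the PRINTED
2008 base hypothesis for Frobenioids of perfect and ISOTROPIC type. Here the isotropy hypothesis is relaxed to the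
quasi-isotropy of the typed statement itself, by the printed reduction to `C^istr` (p. 63, first sentence) exactly
as formalised by abc-iut-L1-t13 / abc-iut-L1-t11 for FSM / FSMFF-2024 bases, plus one new input:
* `PreFrobenioid.isOfPerfectType_istr` — **`C` of perfect type ⟹ `C^istr` of perfect type** (a morphism of
  Frobenius type into an isotropic object factors through the isotropic hull of its domain, Prop. 1.9 (v); the
  induced arrow is again of Frobenius type of the same degree; unique lifting of pre-steps is inherited).
Consequences (namespace `FrdI`), all with the typed statements' OWN hypotheses — quasi-isotropic type read off the
typed antecedents / standard type, bases of FSMFF-type AS PRINTED in 2008 — for Frobenioids of PERFECT type: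
* `isPreStep_map_of_quasiIsotropic_of_isOfPerfectType`, `isCoAngularPreStep_map_…`, `isGroupLikeObj_map_…`;
* `thm34ii_ofFunctor_of_isOfPerfectType'` — the typed `PreFrobenioidData.Thm34ii` at `ofFunctor` for EVERY pair
  of Frobenioids of perfect type and every equivalence (antecedents verbatim: quasi-isotropic ×2, FSMFF-2008 ×2);
* `thm34iii_ofFunctor_of_isOfPerfectType'`, `thm34iv_ofFunctor_of_isOfPerfectType'`,
  `thm34v_ofFunctor_of_isOfPerfectType'` — the typed (iii), (iv), (v) likewise (via abc-iut-L1-t11's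
  `FrdI.OfPreSteps.thm34iii_ofFunctor` and abc-iut-w4-d088's `thm34iv_ofFunctor_of_thm34ii_thm34iii` /
  `thm34v_ofFunctor_of_thm34iii`, which carry no base hypothesis).
So the 0-ary named facts `FrdI.Thm34ii/iii/iv/v` (2008 wording) hold ON THE CLASS OF PERFECT FROBENIOIDS; their
residual (GAP-LEDGER G-L1d8-1) is confined to non-perfect Frobenioids over bases in FSMFF-2008 ∖ FSMFF-2024.
No new definition; no statement of the paper is strengthened; nothing here bears on [IUTchIII].
-/

namespace Literature.AlgebraicGeometry.Frobenioids

open CategoryTheory Opposite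

universe w v v' u u'

namespace PreFrobenioid

variable {D : Type u} [Category.{v} D] {Φ : Dᵒᵖ ⥤ CommMonCat.{w}} {C : Type u'} [Category.{v'} C]
  {F : C ⥤ ElemFrobenioid Φ}

set_option backward.isDefEq.respectTransparency false in
/-- **`C` of perfect type ⟹ `C^istr` of perfect type** (Def. 1.2 (iv) for the Frobenioid `C^istr` of
Prop. 1.9 (v)): a morphism of Frobenius type of degree `n` into an isotropic object `B` factors through the
isotropic hull of its domain (universal property of the hull), and the induced arrow `B₀^istr → B` is again of
Frobenius type of degree `n`; the unique lifting of pre-steps along pairs of such morphisms is inherited from `C`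
(all objects and arrows concerned lie in the full subcategory `C^istr`). [cite: MochizukiFrdI2008, Prop. 1.9(v) p.32] -/
theorem isOfPerfectType_istr (hF : IsFrobenioid F) (hperf : IsOfPerfectType F) :
    IsOfPerfectType (istrFunctor F) := by
  have hP := hF.isPreFrobenioid
  intro A n
  obtain ⟨h1, h2⟩ := hperf A.obj n
  refine ⟨fun B hAB => ?_, fun B₁ B₁' B₂ B₂' φ₁ φ₂ hB₁ hB₂ hφ₁ hd₁ hφ₂ hd₂ ψ' hψ' => ?_⟩
  · -- a Frobenius-type morphism of degree `n` into `B`, from an isotropic object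
    obtain ⟨B₀, φ, hφ, hd⟩ := h1 B.obj hAB
    have hhB := isIsotropicHull_hullHom hF B.obj
    haveI : IsIso (hullHom hF B.obj) := B.property (hullHom hF B.obj) hhB.1 hhB.2.1
    have hφ' : IsFrobeniusType F (hullMor hF φ ≫ inv (hullHom hF B.obj)) :=
      IsFrobeniusType.comp_iso hP (isFrobeniusType_hullMor hF φ hφ) (inv (hullHom hF B.obj))
    have hd' : degFr F (hullMor hF φ ≫ inv (hullHom hF B.obj)) = n := by
      rw [degFr_comp, degFr_hullMor, hd, show degFr F (inv (hullHom hF B.obj)) = 1 from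
        (isPreStep_of_isIso F (inv (hullHom hF B.obj))).1, mul_one]
    exact ⟨hullIstr hF B₀, ObjectProperty.homMk (hullMor hF φ ≫ inv (hullHom hF B.obj)),
      (isFrobeniusType_istr_iff hF _).mpr hφ', hd'⟩
  · -- unique lifting of pre-steps, inherited from `C`
    obtain ⟨ψ, ⟨hψ, hsq⟩, huniq⟩ := h2 φ₁.hom φ₂.hom hB₁ hB₂ ((isFrobeniusType_istr_iff hF _).mp hφ₁) hd₁
      ((isFrobeniusType_istr_iff hF _).mp hφ₂) hd₂ ψ'.hom hψ'
    refine ⟨ObjectProperty.homMk ψ, ⟨hψ, ObjectProperty.hom_ext _ hsq⟩, fun χ hχ => ?_⟩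
    exact ObjectProperty.hom_ext _ (huniq χ.hom ⟨hχ.1, congrArg InducedCategory.Hom.hom hχ.2⟩)

end PreFrobenioid

namespace FrdI

section Two

variable {D₁ : Type u} [Category.{v} D₁] {Φ₁ : D₁ᵒᵖ ⥤ CommMonCat.{w}} {C₁ : Type u'}
  [Category.{v'} C₁] {D₂ : Type u} [Category.{v} D₂] {Φ₂ : D₂ᵒᵖ ⥤ CommMonCat.{w}} {C₂ : Type u'}
  [Category.{v'} C₂] {F₁ : C₁ ⥤ ElemFrobenioid Φ₁} {F₂ : C₂ ⥤ ElemFrobenioid Φ₂}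

/-- **Thm. 3.4 (ii), pre-steps — `C₁` of PERFECT quasi-isotropic type, `C₂` quasi-isotropic over a base of
FSMFF-type AS PRINTED (2008)**: reduction to `C^istr` through isotropic hulls (p. 63, as formalised by seats
abc-iut-L1-t13 / t11) + the perfect isotropic core `isPreStep_map_of_isOfPerfectType` on `Ψ^istr`, `C₁^istr`
being of perfect type by `PreFrobenioid.isOfPerfectType_istr`. [cite: MochizukiFrdI2008, Thm. 3.4 (ii) p.63] -/
theorem isPreStep_map_of_quasiIsotropic_of_isOfPerfectType (hF₁ : PreFrobenioid.IsFrobenioid F₁)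
    (hF₂ : PreFrobenioid.IsFrobenioid F₂)
    (hq₁ : (PreFrobenioidData.ofFunctor Φ₁ F₁).IsOfQuasiIsotropicType)
    (hq₂ : (PreFrobenioidData.ofFunctor Φ₂ F₂).IsOfQuasiIsotropicType)
    (hperf₁ : PreFrobenioid.IsOfPerfectType F₁) (hD₂ : IsOfFSMFFType D₂) (Ψ : C₁ ≌ C₂) {A B : C₁}
    {φ : A ⟶ B} (hφ : PreFrobenioid.IsPreStep F₁ φ) : PreFrobenioid.IsPreStep F₂ (Ψ.functor.map φ) := by
  have hP₁ := hF₁.isPreFrobenioid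
  have hP₂ := hF₂.isPreFrobenioid
  -- `Ψ^istr : C₁^istr ≌ C₂^istr`
  haveI : (PreFrobenioid.isotropicObjects F₂).IsClosedUnderIsomorphisms :=
    ⟨fun e hX => PreFrobenioid.IsIsotropic.of_iso hP₂ e.symm hX⟩
  let Ψi : PreFrobenioid.Istr F₁ ≌ PreFrobenioid.Istr F₂ :=
    Ψ.congrFullSubcategory (isotropicObjects_inverseImage hF₁ hq₁ hq₂ Ψ)
  -- isotropic hulls of the endpoints and the induced pre-step between them
  obtain ⟨A', hA, hhA⟩ := hF₁.vii_a A
  obtain ⟨B', hB, hhB⟩ := hF₁.vii_a B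
  obtain ⟨-, hpA, hA'i, hunivA⟩ := id hhA
  obtain ⟨-, hpB, hB'i, -⟩ := id hhB
  obtain ⟨φ', hφ', -⟩ := hunivA (φ ≫ hB) hB'i
  have hφ'p : PreFrobenioid.IsPreStep F₁ φ' :=
    (PreFrobenioid.isPreStep_factors F₁ hP₁.isTotallyEpimorphic_base
      (show PreFrobenioid.IsPreStep F₁ (hA ≫ φ') by
        rw [hφ']; exact PreFrobenioid.IsPreStep.comp F₁ hφ hpB)).1
  -- apply the perfect isotropic core to `Ψ^istr`
  let a : PreFrobenioid.Istr F₁ := ⟨A', hA'i⟩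
  let b : PreFrobenioid.Istr F₁ := ⟨B', hB'i⟩
  let f : a ⟶ b := ObjectProperty.homMk φ'
  have hf : PreFrobenioid.IsPreStep (PreFrobenioid.istrFunctor F₁) f := hφ'p
  have hcore := isPreStep_map_of_isOfPerfectType (PreFrobenioid.isFrobenioid_istr hF₁)
    (PreFrobenioid.isFrobenioid_istr hF₂) (fun X => PreFrobenioid.isIsotropic_istr X)
    (fun X => PreFrobenioid.isIsotropic_istr X) (PreFrobenioid.isOfPerfectType_istr hF₁ hperf₁) hD₂ Ψi hf
  have hΨφ' : PreFrobenioid.IsPreStep F₂ (Ψ.functor.map φ') := hcore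
  -- transfer along the hulls: `Ψφ ≫ Ψh_B = Ψh_A ≫ Ψφ'`
  obtain ⟨-, hΨhAp, -, -⟩ := isIsotropicHull_map hF₁ hF₂ hq₁ hq₂ Ψ hhA
  have hcomp : PreFrobenioid.IsPreStep F₂ (Ψ.functor.map φ ≫ Ψ.functor.map hB) := by
    rw [← Functor.map_comp, ← hφ', Functor.map_comp]
    exact PreFrobenioid.IsPreStep.comp F₂ hΨhAp hΨφ'
  exact (PreFrobenioid.isPreStep_factors F₂ hP₂.isTotallyEpimorphic_base hcomp).2

/-- **Thm. 3.4 (ii), co-angular pre-steps — perfect quasi-isotropic type, printed base hypothesis** (Prop. 1.7 (iv):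
a pre-step is co-angular iff mid-adjoint to the isometric pre-steps, which `Ψ⁻¹` preserves by Thm. 3.4 (i)).
[cite: MochizukiFrdI2008, Thm. 3.4 (ii) p.63] -/
theorem isCoAngularPreStep_map_of_quasiIsotropic_of_isOfPerfectType
    (hF₁ : PreFrobenioid.IsFrobenioid F₁) (hF₂ : PreFrobenioid.IsFrobenioid F₂)
    (hq₁ : (PreFrobenioidData.ofFunctor Φ₁ F₁).IsOfQuasiIsotropicType)
    (hq₂ : (PreFrobenioidData.ofFunctor Φ₂ F₂).IsOfQuasiIsotropicType)
    (hperf₁ : PreFrobenioid.IsOfPerfectType F₁) (hD₂ : IsOfFSMFFType D₂) (Ψ : C₁ ≌ C₂) {A B : C₁}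
    {φ : A ⟶ B} (hφ : PreFrobenioid.IsCoAngularPreStep F₁ φ) :
    PreFrobenioid.IsCoAngularPreStep F₂ (Ψ.functor.map φ) := by
  have hp := isPreStep_map_of_quasiIsotropic_of_isOfPerfectType hF₁ hF₂ hq₁ hq₂ hperf₁ hD₂ Ψ hφ.2
  refine ⟨?_, hp⟩
  rw [PreFrobenioid.isCoAngular_iff_isMidAdjoint_of_isPreStep F₂ hF₂ _ hp]
  have h1 := (PreFrobenioid.isCoAngular_iff_isMidAdjoint_of_isPreStep F₁ hF₁ _ hφ.2).1 hφ.1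
  refine h1.map_equivalence Ψ (fun X Y β hβ => ?_)
  obtain ⟨hi, hpre⟩ := isIsometry_isPreStep_map hF₂ hF₁ hq₂ hq₁ Ψ.symm hβ.1 hβ.2
  exact ⟨hi, hpre⟩

/-- **Thm. 3.4 (ii), group-like objects — `C₂` of PERFECT quasi-isotropic type, `D₁` of FSMFF-type as
printed** (through the isotropic hull and the core for `(Ψ^istr)⁻¹`). [cite: MochizukiFrdI2008, Thm. 3.4 (ii) p.63] -/
theorem isGroupLikeObj_map_of_quasiIsotropic_of_isOfPerfectType
    (hF₁ : PreFrobenioid.IsFrobenioid F₁) (hF₂ : PreFrobenioid.IsFrobenioid F₂)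
    (hq₁ : (PreFrobenioidData.ofFunctor Φ₁ F₁).IsOfQuasiIsotropicType)
    (hq₂ : (PreFrobenioidData.ofFunctor Φ₂ F₂).IsOfQuasiIsotropicType)
    (hperf₂ : PreFrobenioid.IsOfPerfectType F₂) (hD₁ : IsOfFSMFFType D₁) (Ψ : C₁ ≌ C₂) {A : C₁}
    (hA : PreFrobenioid.IsGroupLikeObj F₁ A) : PreFrobenioid.IsGroupLikeObj F₂ (Ψ.functor.obj A) := by
  have hP₁ := hF₁.isPreFrobenioid
  have hP₂ := hF₂.isPreFrobenioid
  haveI : (PreFrobenioid.isotropicObjects F₂).IsClosedUnderIsomorphisms :=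
    ⟨fun e hX => PreFrobenioid.IsIsotropic.of_iso hP₂ e.symm hX⟩
  let Ψi : PreFrobenioid.Istr F₁ ≌ PreFrobenioid.Istr F₂ :=
    Ψ.congrFullSubcategory (isotropicObjects_inverseImage hF₁ hq₁ hq₂ Ψ)
  obtain ⟨A', h, hh⟩ := hF₁.vii_a A
  obtain ⟨-, hp, hA'i, -⟩ := id hh
  haveI : IsIso (PreFrobenioid.Base F₁ h) := hp.2
  -- `A'` is group-like
  have hA' : PreFrobenioid.IsGroupLikeObj F₁ A' := fun x => by
    have := hA (pull Φ₁ (PreFrobenioid.Base F₁ h) x)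
    exact (hP₁.isMonoidOn.isCharInjective (PreFrobenioid.Base F₁ h)).1 (this.trans (map_one _).symm)
  -- through `Ψ^istr`
  have hcore : PreFrobenioid.IsGroupLikeObj F₂ (Ψ.functor.obj A') :=
    isGroupLikeObj_map_of_isOfPerfectType (PreFrobenioid.isFrobenioid_istr hF₁)
      (PreFrobenioid.isFrobenioid_istr hF₂) (fun X => PreFrobenioid.isIsotropic_istr X)
      (fun X => PreFrobenioid.isIsotropic_istr X) (PreFrobenioid.isOfPerfectType_istr hF₂ hperf₂) hD₁ Ψi
      (A := ⟨A', hA'i⟩) hA'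
  -- back along the base-isomorphism `Ψ h`
  obtain ⟨-, hΨhp, -, -⟩ := isIsotropicHull_map hF₁ hF₂ hq₁ hq₂ Ψ hh
  haveI : IsIso (PreFrobenioid.Base F₂ (Ψ.functor.map h)) := hΨhp.2
  intro x
  have hx : x = pull Φ₂ (PreFrobenioid.Base F₂ (Ψ.functor.map h))
      (pull Φ₂ (inv (PreFrobenioid.Base F₂ (Ψ.functor.map h))) x) := by
    rw [← pull_comp, IsIso.hom_inv_id, pull_id]
  rw [hx, hcore (pull Φ₂ (inv (PreFrobenioid.Base F₂ (Ψ.functor.map h))) x), map_one]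

/-- **The typed [FrdI] Thm. 3.4 (ii), `PreFrobenioidData.Thm34ii`, HOLDS VERBATIM for every pair of Frobenioids
of PERFECT type and every equivalence `Ψ`** — its own antecedents (quasi-isotropic type ×2, bases of
FSMFF-type in the printed 2008 sense ×2) are the ones consumed. [cite: MochizukiFrdI2008, Thm. 3.4 (ii) p.62] -/
theorem thm34ii_ofFunctor_of_isOfPerfectType' (hF₁ : PreFrobenioid.IsFrobenioid F₁)
    (hF₂ : PreFrobenioid.IsFrobenioid F₂) (hperf₁ : PreFrobenioid.IsOfPerfectType F₁)
    (hperf₂ : PreFrobenioid.IsOfPerfectType F₂) (Ψ : C₁ ≌ C₂) :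
    (PreFrobenioidData.ofFunctor Φ₁ F₁).Thm34ii (PreFrobenioidData.ofFunctor Φ₂ F₂) Ψ := by
  intro hq₁ hq₂ hD₁ hD₂
  refine ⟨fun A B φ hφ => isPreStep_map_of_quasiIsotropic_of_isOfPerfectType hF₁ hF₂ hq₁ hq₂ hperf₁ hD₂ Ψ hφ,
    fun A B φ hφ => ?_,
    fun A hA => isGroupLikeObj_map_of_quasiIsotropic_of_isOfPerfectType hF₁ hF₂ hq₁ hq₂ hperf₂ hD₁ Ψ hA⟩
  have h := isCoAngularPreStep_map_of_quasiIsotropic_of_isOfPerfectType hF₁ hF₂ hq₁ hq₂ hperf₁ hD₂ Ψ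
    ⟨(PreFrobenioidData.ofFunctor_isCoAngular F₁ φ).1 hφ.1, hφ.2⟩
  exact ⟨(PreFrobenioidData.ofFunctor_isCoAngular F₂ _).2 h.1, h.2⟩

/-- The same for `Ψ⁻¹`. [cite: MochizukiFrdI2008, Thm. 3.4 (ii) p.62] -/
theorem thm34ii_ofFunctor_symm_of_isOfPerfectType' (hF₁ : PreFrobenioid.IsFrobenioid F₁)
    (hF₂ : PreFrobenioid.IsFrobenioid F₂) (hperf₁ : PreFrobenioid.IsOfPerfectType F₁)
    (hperf₂ : PreFrobenioid.IsOfPerfectType F₂) (Ψ : C₁ ≌ C₂) :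
    (PreFrobenioidData.ofFunctor Φ₂ F₂).Thm34ii (PreFrobenioidData.ofFunctor Φ₁ F₁) Ψ.symm :=
  thm34ii_ofFunctor_of_isOfPerfectType' hF₂ hF₁ hperf₂ hperf₁ Ψ.symm

/-- **The typed [FrdI] Thm. 3.4 (iii), `PreFrobenioidData.Thm34iii`, HOLDS VERBATIM for every pair of Frobenioids
of PERFECT type and every `Ψ`** (standard type supplies quasi-isotropy and the printed base hypothesis; the
(ii)-inputs of abc-iut-L1-t11's `OfPreSteps.thm34iii_ofFunctor` come from the theorems above).
[cite: MochizukiFrdI2008, Thm. 3.4 (iii) p.62] -/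
theorem thm34iii_ofFunctor_of_isOfPerfectType' (hF₁ : PreFrobenioid.IsFrobenioid F₁)
    (hF₂ : PreFrobenioid.IsFrobenioid F₂) (hperf₁ : PreFrobenioid.IsOfPerfectType F₁)
    (hperf₂ : PreFrobenioid.IsOfPerfectType F₂) (Ψ : C₁ ≌ C₂) :
    (PreFrobenioidData.ofFunctor Φ₁ F₁).Thm34iii (PreFrobenioidData.ofFunctor Φ₂ F₂) Ψ := fun hs₁ hs₂ hB =>
  OfPreSteps.thm34iii_ofFunctor hF₁ hF₂ Ψ
    (fun _ _ _ hφ => isPreStep_map_of_quasiIsotropic_of_isOfPerfectType hF₁ hF₂ hs₁.quasiIsotropic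
      hs₂.quasiIsotropic hperf₁ hs₂.fsmff Ψ hφ)
    (fun _ _ _ hφ => isPreStep_map_of_quasiIsotropic_of_isOfPerfectType hF₂ hF₁ hs₂.quasiIsotropic
      hs₁.quasiIsotropic hperf₂ hs₁.fsmff Ψ.symm hφ)
    (fun _ hA => isGroupLikeObj_map_of_quasiIsotropic_of_isOfPerfectType hF₁ hF₂ hs₁.quasiIsotropic
      hs₂.quasiIsotropic hperf₂ hs₁.fsmff Ψ hA)
    (fun _ hA => isGroupLikeObj_map_of_quasiIsotropic_of_isOfPerfectType hF₂ hF₁ hs₂.quasiIsotropic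
      hs₁.quasiIsotropic hperf₁ hs₂.fsmff Ψ.symm hA)
    hs₁ hs₂ hB

/-- The same for `Ψ⁻¹`. [cite: MochizukiFrdI2008, Thm. 3.4 (iii) p.62] -/
theorem thm34iii_ofFunctor_symm_of_isOfPerfectType' (hF₁ : PreFrobenioid.IsFrobenioid F₁)
    (hF₂ : PreFrobenioid.IsFrobenioid F₂) (hperf₁ : PreFrobenioid.IsOfPerfectType F₁)
    (hperf₂ : PreFrobenioid.IsOfPerfectType F₂) (Ψ : C₁ ≌ C₂) :
    (PreFrobenioidData.ofFunctor Φ₂ F₂).Thm34iii (PreFrobenioidData.ofFunctor Φ₁ F₁) Ψ.symm :=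
  thm34iii_ofFunctor_of_isOfPerfectType' hF₂ hF₁ hperf₂ hperf₁ Ψ.symm

/-- **The typed [FrdI] Thm. 3.4 (iv) (preservation part), `PreFrobenioidData.Thm34iv`, HOLDS VERBATIM for every
pair of Frobenioids of PERFECT type and every `Ψ`.** [cite: MochizukiFrdI2008, Thm. 3.4 (iv) p.63] -/
theorem thm34iv_ofFunctor_of_isOfPerfectType' (hF₁ : PreFrobenioid.IsFrobenioid F₁)
    (hF₂ : PreFrobenioid.IsFrobenioid F₂) (hperf₁ : PreFrobenioid.IsOfPerfectType F₁)
    (hperf₂ : PreFrobenioid.IsOfPerfectType F₂) (Ψ : C₁ ≌ C₂) :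
    (PreFrobenioidData.ofFunctor Φ₁ F₁).Thm34iv (PreFrobenioidData.ofFunctor Φ₂ F₂) Ψ :=
  thm34iv_ofFunctor_of_thm34ii_thm34iii hF₁ hF₂ Ψ
    (thm34ii_ofFunctor_of_isOfPerfectType' hF₁ hF₂ hperf₁ hperf₂ Ψ)
    (thm34ii_ofFunctor_symm_of_isOfPerfectType' hF₁ hF₂ hperf₁ hperf₂ Ψ)
    (thm34iii_ofFunctor_of_isOfPerfectType' hF₁ hF₂ hperf₁ hperf₂ Ψ)
    (thm34iii_ofFunctor_symm_of_isOfPerfectType' hF₁ hF₂ hperf₁ hperf₂ Ψ)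

/-- **The typed [FrdI] Thm. 3.4 (v), `PreFrobenioidData.Thm34v`, HOLDS VERBATIM for every pair of Frobenioids of
PERFECT type and every `Ψ`.** [cite: MochizukiFrdI2008, Thm. 3.4 (v) p.63] -/
theorem thm34v_ofFunctor_of_isOfPerfectType' (hF₁ : PreFrobenioid.IsFrobenioid F₁)
    (hF₂ : PreFrobenioid.IsFrobenioid F₂) (hperf₁ : PreFrobenioid.IsOfPerfectType F₁)
    (hperf₂ : PreFrobenioid.IsOfPerfectType F₂) (Ψ : C₁ ≌ C₂) :
    (PreFrobenioidData.ofFunctor Φ₁ F₁).Thm34v (PreFrobenioidData.ofFunctor Φ₂ F₂) Ψ :=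
  thm34v_ofFunctor_of_thm34iii hF₁ hF₂ Ψ
    (thm34iii_ofFunctor_of_isOfPerfectType' hF₁ hF₂ hperf₁ hperf₂ Ψ)
    (thm34iii_ofFunctor_symm_of_isOfPerfectType' hF₁ hF₂ hperf₁ hperf₂ Ψ)

end Two

end FrdI

end Literature.AlgebraicGeometry.Frobenioids
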